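/-
Copyright (c) 2026 the pub-hodgecm-mathlib formalisation cell (harness21).  Prover seat hodgecm-mathlib-K2E1b-p16 (g0),
Track B «K2-LIT» ∕ h413 (stmt-HodgeConjecture-24833), line K2_E1b «GKCohomologyU21», unit U6 «LEVEL-B PIN», file #18:
payment of the socket `K2E1bGKCohomologyU21.U456.sig_K2E1bClassEqArchDegOneOfPType` — A COH-UNITARY `K`-TYPE MODULE WITH CASIMIR `0`
CONTAINING A `𝔭`-TYPE IS THE CLASS OF RECORD `[J^±]`.  2026-09-03.
-/
import Summits.HodgeConjecture.HodgeConjecture.Theorems.F0P3bArchDegOneClass      -- ★ `ofModule_eq_archDegOneClass`, `archDegOneClass`, `IsCohUnitaryIrrep`, `G21`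
import Summits.HodgeConjecture.HodgeConjecture.Theorems.F0P3bKTypeIntegration       -- ★ `KIdx`, `kvec`, `ActsOnKTypes` (+ `GKModulesAdCompatOfWeakDeriv`)
import Literature.RepresentationTheory.GKModuleIrrClass                             -- ★ `GKIrrClass.ofModule`
import Literature.RepresentationTheory.BorelWallach2000.UpqMaximalCompactExp         -- ★ `upq_expK_surjective` (`K = exp 𝔨`)
import Literature.Algebra.Lie.ChevalleyEilenbergWedgeTwo                            -- ★ `oneCochain`
import Summits.HodgeConjecture.HodgeConjecture.Theorems.K2E1bClassEqArchDegOneOfPTypeKFixed   -- ★ satellite (p854877): `apply_Ad_of_expK_surjective`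
import HarnessLib

/-!
# K2_E1b road (h413 = stmt-HodgeConjecture-24833), unit U6 «LEVEL-B PIN», file #18:
# the class of a `K`-type module with Casimir `0` and a `𝔭`-type is `archDegOneClass (±1)`

Cell `pub/hodgecm-mathlib` (D-0151), Track B (21-frontier RULING «PUSH BOTH» 2026-09-03, director req621∕req624, chair K2-lead,
dealer K2E1b-plan), socket module `Summits/HodgeConjecture/HodgeConjecture/Cruxes/H413/Lines/K2_E1b_GKCohomologyU21_U456_Cohomology.lean`
(planner K2E1b-plan (g0)), socket **`sig_K2E1bClassEqArchDegOneOfPType`** (SIGS TABLE row #18, size L), paid TOKEN FOR TOKEN by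
`classEqArchDegOneOfPType` (§C).  STATEMENT: let `V = ⊕_{(n,m) ∈ S} V_{n,m}` (`KIdx S →₀ ℂ`) carry an irreducible unitary cohomological
`(𝔲(2,1), K)`-structure `(ρK, ρ𝔤)` (★ `IsCohUnitaryIrrep`) whose `𝔨`-action is Kovačević's (★ `ActsOnKTypes`), with the trace-form Casimir
★ `upqCasimirOp` acting by `0`; if a `𝔭`-type label `(2, 3)` or `(2, −3)` lies in `S` then for some sign `δ` the class of `V` in
★ `GKIrrClass U(2,1)` is the class of record ★ `archDegOneClass δ` (`[J^δ]`, Rogawski Prop. 15.2.1 (b)).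

THE MATHEMATICS (Borel–Wallach II Prop. 3.1 ∕ Cor. 3.3, I §1.2 ∕ §5.1, VI Thm. 4.11; Vogan–Zuckerman Thm. 5.6 via the tree's EXIT 2).
* §A (satellite file ★ `K2E1bClassEqArchDegOneOfPTypeKFixed`, BW 0 §2.5 ∕ I §5.1): a `𝔨`-equivariant `ℝ`-linear `f : 𝔤 → V`
  (`f ⁅Y, X⁆ = ρ𝔤(Y) f(X)`, `Y ∈ 𝔨`) is `K`-equivariant, `f (Ad k X) = ρK(k) f(X)`, on `K = exp 𝔨` (★ `apply_Ad_of_expK_surjective` with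
  ★ `upq_expK_surjective`) — the ODE∕constancy argument of ★ `GKModulesAdCompatOfWeakDeriv` with `f` in place of `ρ𝔤`.
* §B THE `𝔭`-TYPE INTERTWINERS.  In the ★ `kTypeMat` convention `𝔭⁺ ≅ V_{2,3}` and `𝔭⁻ ≅ V_{2,−3}` as `𝔨`-modules; explicitly
  `X ↦ X₀₂ • u¹_{2,3} − X₁₂ • u²_{2,3}` (complex-linear in the upper-right block `X₁₂`) resp. `X ↦ X₂₀ • u²_{2,−3} + X₂₁ • u¹_{2,−3}`
  (complex-linear in `X₂₁ = X₁₂ᴴ`) are `𝔨`-equivariant `𝔲(2,1) → V` (Kovačević's `u`-basis formulas on `V_{2,±3}`, `act_kvec_*`, against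
  `⁅Y, X⁆₁₂ = Y₁₁X₁₂ − X₁₂Y₂₂`, `lie_apply_*`), vanish on `𝔨`, are `K`-fixed by §A, hence relative 1-cochains in the tree's
  `gkComplex`; their values are `z₀`-eigenvectors of weight `±i` (★ `mem_upqType_iff`: type `δ = ±1`), and they do not vanish at `X_{E₀₀}`
  (`exists_cochain_type_one`, `exists_cochain_type_neg_one`).
* §C THE HEAD.  Unitarity along `𝔭` (★ `IsUnitaryAlongP`, carried by `IsCohUnitaryIrrep`) and Casimir `0` make every `(𝔤, K)`-cochain closed and
  `C^q ≅ H^q` (★ `upq_d_eq_zero_of_casimir_eq_zero`, ★ `upqClassMap_bijective` — BW II Cor. 3.3 "all cochains are closed, the cohomology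
  identifies to the cochain complex"), so the cochain of §B is a non-zero element of `H¹_{±1}` (★ `mem_upqTypeClasses_iff`), and EXIT 2 rigidity
  ★ `ofModule_eq_archDegOneClass` (BW VI 4.11 (1), T6c∕T6r) names the class.
IDLE HYPOTHESES (for the record): `1 ≤ n` on `S` and the `ρK`-stability of the `K`-type blocks are not used — with `K = exp 𝔨` the `K`-action is
determined by `ρ𝔤|_𝔨` (§A), so the latter is automatic; both are kept because the socket's bytes are frozen.  No vacuity: the conclusion is an
equation of classes and the hypotheses are met by the honest `J`-carriers of the line (U0∕U2).

HONEST LABEL: HC_CM is proved only modulo the 7 printed citations (2 remaining named inputs: hLiu418 = stmt-HodgeConjecture-24832,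
h413 = stmt-HodgeConjecture-24833) until rung 0 closes; this file is a `--supports stmt-HodgeConjecture-24833` helper (scaffold of the
K2_E1b road, consumed BY NAME by the junction J1 ∕ row 10) and retires nothing by itself.

## References
* [BorelWallach2000] A. Borel, N. Wallach, *Continuous cohomology, discrete subgroups, and representations of reductive groups*, 2nd ed.,
  Math. Surveys Monogr. 67, AMS (2000): 0 §2.5; I §1.2 (1)–(2), §5.1 (1)–(3); II §1.1, Prop. 3.1, Cor. 3.3, §4.2 (3); VI §4 (11), Thm. 4.11.
* [Rogawski1990] J. Rogawski, *Automorphic Representations of Unitary Groups in Three Variables*, Ann. of Math. Stud. 123 (1990), Prop. 15.2.1 (b).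
* [VoganZuckerman1984] D. Vogan, G. Zuckerman, Unitary representations with non-zero cohomology, Compositio Math. 53 (1984), Thm. 5.6.
* [Kovacevic2021] D. Kovačević, *(𝔤, K)-modules of SU(2,1) from K-types*, §3 Def. 1, §6 (the `u`-basis formulas and the `K`-type labels).
-/

set_option autoImplicit false
-- the mandated namespace repeats the single-problem summit's segment (`HodgeConjecture.HodgeConjecture`)
set_option linter.dupNamespace false

-- Mathlib idiom (as in `GKModules`, `GKCohomology`, the `Upq*` files): commutator bracket on `Module.End` ∕ matrices
attribute [local instance 100] LieRing.ofAssociativeRing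


noncomputable section

namespace Summit.HodgeConjecture.HodgeConjecture.Cruxes.H413.K2E1bClassEqArchDegOneOfPType

open Literature.Algebra.Lie Literature.Algebra.Lie.ChevalleyEilenberg
open Literature.NumberTheory.Automorphic
open Literature.RepresentationTheory
open Literature.RepresentationTheory.BorelWallach2000
open Literature.RepresentationTheory.KonnoKonno2007 Literature.RepresentationTheory.KonnoKonno2007.RealDualPair
open Literature.RepresentationTheory.KonnoKonno2007.RealDualPair.UForm
open Summit.HodgeConjecture.HodgeConjecture.Cruxes.H413.F0P3bLocalAPacketsDefs (G21)
open Summit.HodgeConjecture.HodgeConjecture.Cruxes.H413.F0P3bArchDegOnePackage (IsCohUnitaryIrrep)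
open Summit.HodgeConjecture.HodgeConjecture.Cruxes.H413.F0P3bArchDegOneClass (archDegOneClass ofModule_eq_archDegOneClass)
open Summit.HodgeConjecture.HodgeConjecture.Cruxes.H413.F0P3bKTypeIntegration (KIdx kvec ActsOnKTypes kvec_of_pos kvec_of_neg)
open Summit.HodgeConjecture.HodgeConjecture.Cruxes.H413.K2E1bClassEqArchDegOneOfPTypeKFixed (apply_Ad_of_expK_surjective)



/-! ## §B The `𝔭`-type intertwiners `𝔭^± → V_{2,±3}` as relative 1-cochains of `(𝔲(2,1), K)` -/

section PType

variable {S : Set (ℤ × ℤ)} {ρ𝔤 : G21.lie →ₗ⁅ℝ⁆ Module.End ℂ (KIdx S →₀ ℂ)}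

/-- Entries of `𝔨 = 𝔲(2) ⊕ 𝔲(1)`: the off-diagonal blocks of `Y ∈ 𝔨` vanish. [cite: BorelWallach2000, II §1.1 (3)] -/
theorem compactLie_apply_inl_inr (Y : G21.compactLie) (i : Fin 2) (b : Fin 1) :
    (Y : Matrix (Fin 2 ⊕ Fin 1) (Fin 2 ⊕ Fin 1) ℂ) (Sum.inl i) (Sum.inr b) = 0 ∧
      (Y : Matrix (Fin 2 ⊕ Fin 1) (Fin 2 ⊕ Fin 1) ℂ) (Sum.inr b) (Sum.inl i) = 0 := by
  have hk : LieSubalgebra.inclusion G21.compactLie_le_lie Y ∈ G21.kInLie := ⟨Y, rfl⟩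
  have h12 := (upq_mem_kInLie_iff_blocks _).1 hk
  have h21 := (upq_lie_blocks (LieSubalgebra.inclusion G21.compactLie_le_lie Y)).2.2
  rw [h12, Matrix.conjTranspose_zero] at h21
  exact ⟨congr_fun (congr_fun h12 i) b, congr_fun (congr_fun h21 b) i⟩

/-- The `𝔭⁺`-entries of `⁅Y, X⁆` for `Y ∈ 𝔨`: `⁅Y, X⁆₁₂ = Y₁₁ X₁₂ − X₁₂ Y₂₂`, entrywise. [cite: BorelWallach2000, II §1.1 (4)] -/
theorem lie_apply_inl_inr (Y : G21.compactLie) (X : G21.lie) (i : Fin 2) :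
    ((⁅LieSubalgebra.inclusion G21.compactLie_le_lie Y, X⁆ : G21.lie) : Matrix (Fin 2 ⊕ Fin 1) (Fin 2 ⊕ Fin 1) ℂ)
        (Sum.inl i) (Sum.inr 0) =
      (Y : Matrix (Fin 2 ⊕ Fin 1) (Fin 2 ⊕ Fin 1) ℂ) (Sum.inl i) (Sum.inl 0) *
          (X : Matrix (Fin 2 ⊕ Fin 1) (Fin 2 ⊕ Fin 1) ℂ) (Sum.inl 0) (Sum.inr 0) +
        (Y : Matrix (Fin 2 ⊕ Fin 1) (Fin 2 ⊕ Fin 1) ℂ) (Sum.inl i) (Sum.inl 1) *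
          (X : Matrix (Fin 2 ⊕ Fin 1) (Fin 2 ⊕ Fin 1) ℂ) (Sum.inl 1) (Sum.inr 0) -
        (X : Matrix (Fin 2 ⊕ Fin 1) (Fin 2 ⊕ Fin 1) ℂ) (Sum.inl i) (Sum.inr 0) *
          (Y : Matrix (Fin 2 ⊕ Fin 1) (Fin 2 ⊕ Fin 1) ℂ) (Sum.inr 0) (Sum.inr 0) := by
  obtain ⟨hi, -⟩ := compactLie_apply_inl_inr Y i 0
  have h0 := (compactLie_apply_inl_inr Y 0 0).1
  have h1 := (compactLie_apply_inl_inr Y 1 0).1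
  have hc : ((LieSubalgebra.inclusion G21.compactLie_le_lie Y : G21.lie) : Matrix (Fin 2 ⊕ Fin 1) (Fin 2 ⊕ Fin 1) ℂ) =
      (Y : Matrix (Fin 2 ⊕ Fin 1) (Fin 2 ⊕ Fin 1) ℂ) := rfl
  rw [LieSubalgebra.coe_bracket, Ring.lie_def, hc, Matrix.sub_apply, Matrix.mul_apply, Matrix.mul_apply,
    Fintype.sum_sum_type, Fintype.sum_sum_type, Fin.sum_univ_two, Fin.sum_univ_two]
  simp only [Finset.univ_unique, Fin.default_eq_zero, Finset.sum_singleton, hi, h0, h1]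
  ring

/-- The `𝔭⁻`-entries of `⁅Y, X⁆` for `Y ∈ 𝔨`: `⁅Y, X⁆₂₁ = Y₂₂ X₂₁ − X₂₁ Y₁₁`, entrywise. [cite: BorelWallach2000, II §1.1 (4)] -/
theorem lie_apply_inr_inl (Y : G21.compactLie) (X : G21.lie) (j : Fin 2) :
    ((⁅LieSubalgebra.inclusion G21.compactLie_le_lie Y, X⁆ : G21.lie) : Matrix (Fin 2 ⊕ Fin 1) (Fin 2 ⊕ Fin 1) ℂ)
        (Sum.inr 0) (Sum.inl j) =
      (Y : Matrix (Fin 2 ⊕ Fin 1) (Fin 2 ⊕ Fin 1) ℂ) (Sum.inr 0) (Sum.inr 0) *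
          (X : Matrix (Fin 2 ⊕ Fin 1) (Fin 2 ⊕ Fin 1) ℂ) (Sum.inr 0) (Sum.inl j) -
        ((X : Matrix (Fin 2 ⊕ Fin 1) (Fin 2 ⊕ Fin 1) ℂ) (Sum.inr 0) (Sum.inl 0) *
            (Y : Matrix (Fin 2 ⊕ Fin 1) (Fin 2 ⊕ Fin 1) ℂ) (Sum.inl 0) (Sum.inl j) +
          (X : Matrix (Fin 2 ⊕ Fin 1) (Fin 2 ⊕ Fin 1) ℂ) (Sum.inr 0) (Sum.inl 1) *
            (Y : Matrix (Fin 2 ⊕ Fin 1) (Fin 2 ⊕ Fin 1) ℂ) (Sum.inl 1) (Sum.inl j)) := by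
  obtain ⟨-, hj⟩ := compactLie_apply_inl_inr Y j 0
  have h0 := (compactLie_apply_inl_inr Y 0 0).2
  have h1 := (compactLie_apply_inl_inr Y 1 0).2
  have hc : ((LieSubalgebra.inclusion G21.compactLie_le_lie Y : G21.lie) : Matrix (Fin 2 ⊕ Fin 1) (Fin 2 ⊕ Fin 1) ℂ) =
      (Y : Matrix (Fin 2 ⊕ Fin 1) (Fin 2 ⊕ Fin 1) ℂ) := rfl
  rw [LieSubalgebra.coe_bracket, Ring.lie_def, hc, Matrix.sub_apply, Matrix.mul_apply, Matrix.mul_apply,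
    Fintype.sum_sum_type, Fintype.sum_sum_type, Fin.sum_univ_two, Fin.sum_univ_two]
  simp only [Finset.univ_unique, Fin.default_eq_zero, Finset.sum_singleton, hj, h0, h1]
  ring

/-! ### Kovačević's `u`-basis formulas on a two-dimensional `K`-type `V_{2,m}` (the `𝔭`-types are `m = ±3`) -/

/-- `ρ𝔤(Y) u¹_{2,m} = c₁(Y) u¹ − y₁₀ u²` for `Y ∈ 𝔨` (`ActsOnKTypes` at `(n, k) = (2, 1)`; `u⁰ = 0`). [cite: Kovacevic2021, §3 Def. 1] -/
theorem act_kvec_two_one (hacts : ActsOnKTypes S ρ𝔤) {m : ℤ} (hS : ((2 : ℤ), m) ∈ S) (Y : G21.compactLie) :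
    ρ𝔤 (LieSubalgebra.inclusion G21.compactLie_le_lie Y) (kvec S 2 m 1) =
      ((2 * (Y : Matrix (Fin 2 ⊕ Fin 1) (Fin 2 ⊕ Fin 1) ℂ) (Sum.inl 0) (Sum.inl 0) - (Y : Matrix (Fin 2 ⊕ Fin 1) (Fin 2 ⊕ Fin 1) ℂ) (Sum.inl 1) (Sum.inl 1)
            - (Y : Matrix (Fin 2 ⊕ Fin 1) (Fin 2 ⊕ Fin 1) ℂ) (Sum.inr 0) (Sum.inr 0)) / 3 +
          ((Y : Matrix (Fin 2 ⊕ Fin 1) (Fin 2 ⊕ Fin 1) ℂ) (Sum.inl 0) (Sum.inl 0) + (Y : Matrix (Fin 2 ⊕ Fin 1) (Fin 2 ⊕ Fin 1) ℂ) (Sum.inl 1) (Sum.inl 1)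
            - 2 * (Y : Matrix (Fin 2 ⊕ Fin 1) (Fin 2 ⊕ Fin 1) ℂ) (Sum.inr 0) (Sum.inr 0)) / 3 * (((m : ℂ) - 1) / 2)) • kvec S 2 m 1 +
        (-(Y : Matrix (Fin 2 ⊕ Fin 1) (Fin 2 ⊕ Fin 1) ℂ) (Sum.inl 1) (Sum.inl 0)) • kvec S 2 m 2 := by
  have h := hacts Y 2 m 1 hS (by norm_num) (by norm_num)
  rw [h, show ((1 : ℤ) - 1) = 0 from by norm_num, show ((1 : ℤ) + 1) = 2 from by norm_num,
    kvec_of_neg (S := S) (n := 2) (m := m) (k := 0) (fun h' => by omega)]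
  push_cast
  module

/-- `ρ𝔤(Y) u²_{2,m} = c₂(Y) u² − y₀₁ u¹` for `Y ∈ 𝔨` (`ActsOnKTypes` at `(n, k) = (2, 2)`; `u³ = 0`). [cite: Kovacevic2021, §3 Def. 1] -/
theorem act_kvec_two_two (hacts : ActsOnKTypes S ρ𝔤) {m : ℤ} (hS : ((2 : ℤ), m) ∈ S) (Y : G21.compactLie) :
    ρ𝔤 (LieSubalgebra.inclusion G21.compactLie_le_lie Y) (kvec S 2 m 2) =
      (-((2 * (Y : Matrix (Fin 2 ⊕ Fin 1) (Fin 2 ⊕ Fin 1) ℂ) (Sum.inl 0) (Sum.inl 0) - (Y : Matrix (Fin 2 ⊕ Fin 1) (Fin 2 ⊕ Fin 1) ℂ) (Sum.inl 1) (Sum.inl 1)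
            - (Y : Matrix (Fin 2 ⊕ Fin 1) (Fin 2 ⊕ Fin 1) ℂ) (Sum.inr 0) (Sum.inr 0)) / 3) +
          ((Y : Matrix (Fin 2 ⊕ Fin 1) (Fin 2 ⊕ Fin 1) ℂ) (Sum.inl 0) (Sum.inl 0) + (Y : Matrix (Fin 2 ⊕ Fin 1) (Fin 2 ⊕ Fin 1) ℂ) (Sum.inl 1) (Sum.inl 1)
            - 2 * (Y : Matrix (Fin 2 ⊕ Fin 1) (Fin 2 ⊕ Fin 1) ℂ) (Sum.inr 0) (Sum.inr 0)) / 3 * (((m : ℂ) + 1) / 2)) • kvec S 2 m 2 +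
        (-(Y : Matrix (Fin 2 ⊕ Fin 1) (Fin 2 ⊕ Fin 1) ℂ) (Sum.inl 0) (Sum.inl 1)) • kvec S 2 m 1 := by
  have h := hacts Y 2 m 2 hS (by norm_num) (by norm_num)
  rw [h, show ((2 : ℤ) - 1) = 1 from by norm_num, show ((2 : ℤ) + 1) = 3 from by norm_num,
    kvec_of_neg (S := S) (n := 2) (m := m) (k := 3) (fun h' => by omega)]
  push_cast
  module

/-- `ρ𝔤(z₀) = (i m ∕ 3) · id` on `V_{2,m}` (`z₀ = diag(i, i, 0) ∈ 𝔨`): `+i` on the `𝔭`-type `V_{2,3}`, `−i` on `V_{2,−3}`.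
[cite: BorelWallach2000, II §4.2 (3)] [cite: Kovacevic2021, §3 Def. 1] -/
theorem upqZ0_kvec_two (hacts : ActsOnKTypes S ρ𝔤) {m : ℤ} (hS : ((2 : ℤ), m) ∈ S) :
    ρ𝔤 (upqZ0 (Fin 2) (Fin 1)) (kvec S 2 m 1) = (Complex.I * m / 3) • kvec S 2 m 1 ∧
      ρ𝔤 (upqZ0 (Fin 2) (Fin 1)) (kvec S 2 m 2) = (Complex.I * m / 3) • kvec S 2 m 2 := by
  obtain ⟨Y, hY⟩ := (upqZ0_mem_kInLie : upqZ0 (Fin 2) (Fin 1) ∈ G21.kInLie)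
  have hY' : LieSubalgebra.inclusion G21.compactLie_le_lie Y = upqZ0 (Fin 2) (Fin 1) := hY
  have hmat : (Y : Matrix (Fin 2 ⊕ Fin 1) (Fin 2 ⊕ Fin 1) ℂ) = Matrix.fromBlocks (Complex.I • (1 : Matrix (Fin 2) (Fin 2) ℂ)) 0 0 0 := by
    rw [← coe_upqZ0, ← hY']; rfl
  rw [← hY', act_kvec_two_one hacts hS Y, act_kvec_two_two hacts hS Y, hmat]
  constructor <;> (simp; module)

/-! ### The two relative 1-cochains -/

/-- A `1`-cochain in its argument (plumbing). [folklore] -/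
theorem cochain_one_apply {L M : Type*} [LieRing L] [LieAlgebra ℝ L] [AddCommGroup M] [Module ℝ M]
    (f : Cochain ℝ L M 1) (v : Fin 1 → L) : f v = f ![v 0] := by
  congr 1
  funext i
  fin_cases i
  rfl

/-- A `1`-cochain vanishing on every `![x]` is zero (plumbing). [folklore] -/
theorem cochain_one_eq_zero {L M : Type*} [LieRing L] [LieAlgebra ℝ L] [AddCommGroup M] [Module ℝ M]
    (f : Cochain ℝ L M 1) (h : ∀ x, f ![x] = 0) : f = 0 :=
  AlternatingMap.ext fun v => by rw [cochain_one_apply f v, h, AlternatingMap.zero_apply]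

variable {ρK : Representation ℂ G21.maximalCompact (KIdx S →₀ ℂ)}

/-- **The `𝔭⁺ → V_{2,3}` intertwiner is a non-zero relative 1-cochain of type `δ = 1`.**  For a `(𝔤, K)`-module structure on
`V = ⊕_{(n,m) ∈ S} V_{n,m}` whose `𝔨`-action is Kovačević's (`ActsOnKTypes`) and with `(2, 3) ∈ S`, the `ℝ`-linear map
`f : X ↦ X₀₂ • u¹_{2,3} − X₁₂ • u²_{2,3}` (`𝔲(2,1) → V`; complex-linear in the `𝔭⁺`-block `X₁₂ = (X₀₂, X₁₂)ᵀ`, zero on `𝔨`) is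
`𝔨`-equivariant (`u`-basis formulas on `V_{2,3}` vs. `⁅Y, X⁆₁₂ = Y₁₁X₁₂ − X₁₂Y₂₂`), hence `K`-fixed (§A, `K = exp 𝔨`), i.e. a cochain of
`C¹(𝔲(2,1), K; V) = Hom_K(𝔭, V)`; its values are `z₀`-eigenvectors of weight `+i` (type `(1,0)`), and `f(X_{E₀₀}) = u¹_{2,3} ≠ 0`.
[cite: BorelWallach2000, I §1.2 (1)–(2), §5.1 (1)–(3); II §4.2 (3)] [cite: Kovacevic2021, §3 Def. 1; §6] -/
theorem exists_cochain_type_one (hGK : IsGKModule G21 ρK ρ𝔤) (hacts : ActsOnKTypes S ρ𝔤) (hS : ((2 : ℤ), (3 : ℤ)) ∈ S) :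
    ∃ f : Cochain ℝ G21.lie (GKCarrier G21 ρ𝔤) 1, f ∈ upqType ρK ρ𝔤 hGK.ad_compat 1 1 ∧ f ≠ 0 := by
  let ι := GKCarrier.of G21 ρ𝔤
  let φ : G21.lie →ₗ[ℝ] GKCarrier G21 ρ𝔤 :=
    { toFun := fun X => ι ((X : Matrix (Fin 2 ⊕ Fin 1) (Fin 2 ⊕ Fin 1) ℂ) (Sum.inl 0) (Sum.inr 0) • kvec S 2 3 1 -
        (X : Matrix (Fin 2 ⊕ Fin 1) (Fin 2 ⊕ Fin 1) ℂ) (Sum.inl 1) (Sum.inr 0) • kvec S 2 3 2)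
      map_add' := fun X X' => by
        rw [← map_add ι]
        refine congrArg ι ?_
        rw [AddMemClass.coe_add, Matrix.add_apply, Matrix.add_apply, add_smul, add_smul]
        abel
      map_smul' := fun t X => by
        change ι _ = (t : ℂ) • ι _
        rw [← map_smul ι]
        refine congrArg ι ?_
        change (t • (X : Matrix (Fin 2 ⊕ Fin 1) (Fin 2 ⊕ Fin 1) ℂ)) (Sum.inl 0) (Sum.inr 0) • kvec S 2 3 1 -
          (t • (X : Matrix (Fin 2 ⊕ Fin 1) (Fin 2 ⊕ Fin 1) ℂ)) (Sum.inl 1) (Sum.inr 0) • kvec S 2 3 2 = _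
        rw [Matrix.smul_apply, Matrix.smul_apply, Complex.real_smul, Complex.real_smul, smul_sub, mul_smul, mul_smul] }
  have hφ : ∀ X : G21.lie, ι.symm (φ X) = (X : Matrix (Fin 2 ⊕ Fin 1) (Fin 2 ⊕ Fin 1) ℂ) (Sum.inl 0) (Sum.inr 0) • kvec S 2 3 1 -
      (X : Matrix (Fin 2 ⊕ Fin 1) (Fin 2 ⊕ Fin 1) ℂ) (Sum.inl 1) (Sum.inr 0) • kvec S 2 3 2 := fun X => rfl
  -- `𝔨`-equivariance
  have hlie : ∀ (Y : G21.compactLie) (X : G21.lie), φ ⁅LieSubalgebra.inclusion G21.compactLie_le_lie Y, X⁆ =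
      ρ𝔤 (LieSubalgebra.inclusion G21.compactLie_le_lie Y) (φ X) := by
    intro Y X
    apply ι.symm.injective
    change ι.symm (φ _) = ρ𝔤 _ (ι.symm (φ X))
    rw [hφ, hφ, lie_apply_inl_inr, lie_apply_inl_inr, map_sub, map_smul, map_smul,
      act_kvec_two_one hacts hS, act_kvec_two_two hacts hS]
    module
  -- `K`-equivariance (§A with `K = exp 𝔨`)
  have hK := apply_Ad_of_expK_surjective hGK.hasWeakDeriv hlie upq_expK_surjective
  refine ⟨oneCochain G21.lie φ, (mem_upqType_iff ρK ρ𝔤 hGK.ad_compat 1 1 _).2 ⟨?_, fun v => ?_⟩, fun h0 => ?_⟩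
  · refine (mem_gkComplex_succ_iff G21 ρK ρ𝔤 hGK.ad_compat 0 _).2 ⟨fun Z hZ => ⟨?_, ?_⟩, fun k => ?_⟩
    · -- `θ_Z f = 0`
      obtain ⟨Y, rfl⟩ := hZ
      refine cochain_one_eq_zero _ fun X => ?_
      rw [lieDer_one_apply, sub_eq_zero, GKCarrier.bracket_def, oneCochain_apply, oneCochain_apply, Matrix.cons_val_zero,
        Matrix.cons_val_zero]
      exact (hlie Y X).symm
    · -- `i_Z f = 0`
      obtain ⟨Y, rfl⟩ := hZ
      refine AlternatingMap.ext fun v => ?_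
      rw [ins_apply, AlternatingMap.zero_apply, oneCochain_apply, Matrix.cons_val_zero]
      apply ι.symm.injective
      rw [hφ, map_zero]
      change (Y : Matrix (Fin 2 ⊕ Fin 1) (Fin 2 ⊕ Fin 1) ℂ) (Sum.inl 0) (Sum.inr 0) • kvec S 2 3 1 - (Y : Matrix (Fin 2 ⊕ Fin 1) (Fin 2 ⊕ Fin 1) ℂ) (Sum.inl 1) (Sum.inr 0) • kvec S 2 3 2 = 0
      rw [(compactLie_apply_inl_inr Y 0 0).1, (compactLie_apply_inl_inr Y 1 0).1, zero_smul, zero_smul, sub_zero]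
    · -- `k • f = f`
      refine AlternatingMap.ext fun v => ?_
      rw [PairAction.act_apply, oneCochain_apply, oneCochain_apply]
      change ρK k (ι.symm (φ (G21.Ad (Subgroup.inclusion G21.maximalCompact_le_carrier k⁻¹) (v 0)))) = ι.symm (φ (v 0))
      have e : ι.symm (φ (G21.Ad (Subgroup.inclusion G21.maximalCompact_le_carrier k⁻¹) (v 0))) =
          ρK k⁻¹ (ι.symm (φ (v 0))) := congrArg ι.symm (hK k⁻¹ (v 0))
      rw [e, ← Module.End.mul_apply, ← map_mul, mul_inv_cancel, map_one, Module.End.one_apply]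
  · -- type `δ = 1`: the values are `z₀`-eigenvectors of weight `i`
    rw [cochain_one_apply (oneCochain G21.lie φ) v, oneCochain_apply, Matrix.cons_val_zero]
    apply ι.symm.injective
    change ρ𝔤 (upqZ0 (Fin 2) (Fin 1)) (ι.symm (φ (v 0))) = ι.symm (_ • φ (v 0))
    rw [map_smul ι.symm, hφ, map_sub, map_smul, map_smul, (upqZ0_kvec_two hacts hS).1,
      (upqZ0_kvec_two hacts hS).2]
    push_cast
    module
  · -- `f ≠ 0`: `f (X_{E₀₀}) = u¹_{2,3}`
    have h1 := congrArg (fun g : Cochain ℝ G21.lie (GKCarrier G21 ρ𝔤) 1 => ι.symm (g ![upqUnit ((0 : Fin 2), (0 : Fin 1)) 1])) h0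
    simp only [oneCochain_apply, Matrix.cons_val_zero, AlternatingMap.zero_apply, map_zero, hφ, coe_upqUnit,
      Matrix.fromBlocks_apply₁₂, Matrix.single_apply_same, one_smul] at h1
    rw [Matrix.single_apply_of_row_ne (show (0 : Fin 2) ≠ 1 by decide), zero_smul, sub_zero,
      kvec_of_pos ⟨hS, le_refl _, by norm_num⟩] at h1
    exact one_ne_zero (Finsupp.single_eq_zero.1 h1)

/-- **The `𝔭⁻ → V_{2,−3}` intertwiner is a non-zero relative 1-cochain of type `δ = −1`**: with `(2, −3) ∈ S`, the `ℝ`-linear map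
`f : X ↦ X₂₀ • u²_{2,−3} + X₂₁ • u¹_{2,−3}` (complex-linear in the `𝔭⁻`-block `X₂₁ = X₁₂ᴴ`) is `𝔨`-equivariant, hence `K`-fixed, its values
have `z₀`-weight `−i` (type `(0,1)`), and `f(X_{E₀₀}) = u²_{2,−3} ≠ 0`.
[cite: BorelWallach2000, I §1.2 (1)–(2), §5.1 (1)–(3); II §4.2 (3)] [cite: Kovacevic2021, §3 Def. 1; §6] -/
theorem exists_cochain_type_neg_one (hGK : IsGKModule G21 ρK ρ𝔤) (hacts : ActsOnKTypes S ρ𝔤) (hS : ((2 : ℤ), (-3 : ℤ)) ∈ S) :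
    ∃ f : Cochain ℝ G21.lie (GKCarrier G21 ρ𝔤) 1, f ∈ upqType ρK ρ𝔤 hGK.ad_compat 1 (-1) ∧ f ≠ 0 := by
  let ι := GKCarrier.of G21 ρ𝔤
  let φ : G21.lie →ₗ[ℝ] GKCarrier G21 ρ𝔤 :=
    { toFun := fun X => ι ((X : Matrix (Fin 2 ⊕ Fin 1) (Fin 2 ⊕ Fin 1) ℂ) (Sum.inr 0) (Sum.inl 0) • kvec S 2 (-3) 2 +
        (X : Matrix (Fin 2 ⊕ Fin 1) (Fin 2 ⊕ Fin 1) ℂ) (Sum.inr 0) (Sum.inl 1) • kvec S 2 (-3) 1)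
      map_add' := fun X X' => by
        rw [← map_add ι]
        refine congrArg ι ?_
        rw [AddMemClass.coe_add, Matrix.add_apply, Matrix.add_apply, add_smul, add_smul]
        abel
      map_smul' := fun t X => by
        change ι _ = (t : ℂ) • ι _
        rw [← map_smul ι]
        refine congrArg ι ?_
        change (t • (X : Matrix (Fin 2 ⊕ Fin 1) (Fin 2 ⊕ Fin 1) ℂ)) (Sum.inr 0) (Sum.inl 0) • kvec S 2 (-3) 2 +
          (t • (X : Matrix (Fin 2 ⊕ Fin 1) (Fin 2 ⊕ Fin 1) ℂ)) (Sum.inr 0) (Sum.inl 1) • kvec S 2 (-3) 1 = _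
        rw [Matrix.smul_apply, Matrix.smul_apply, Complex.real_smul, Complex.real_smul, smul_add, mul_smul, mul_smul] }
  have hφ : ∀ X : G21.lie, ι.symm (φ X) = (X : Matrix (Fin 2 ⊕ Fin 1) (Fin 2 ⊕ Fin 1) ℂ) (Sum.inr 0) (Sum.inl 0) • kvec S 2 (-3) 2 +
      (X : Matrix (Fin 2 ⊕ Fin 1) (Fin 2 ⊕ Fin 1) ℂ) (Sum.inr 0) (Sum.inl 1) • kvec S 2 (-3) 1 := fun X => rfl
  have hlie : ∀ (Y : G21.compactLie) (X : G21.lie), φ ⁅LieSubalgebra.inclusion G21.compactLie_le_lie Y, X⁆ =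
      ρ𝔤 (LieSubalgebra.inclusion G21.compactLie_le_lie Y) (φ X) := by
    intro Y X
    apply ι.symm.injective
    change ι.symm (φ _) = ρ𝔤 _ (ι.symm (φ X))
    rw [hφ, hφ, lie_apply_inr_inl, lie_apply_inr_inl, map_add, map_smul, map_smul,
      act_kvec_two_one hacts hS, act_kvec_two_two hacts hS]
    module
  have hK := apply_Ad_of_expK_surjective hGK.hasWeakDeriv hlie upq_expK_surjective
  refine ⟨oneCochain G21.lie φ, (mem_upqType_iff ρK ρ𝔤 hGK.ad_compat 1 (-1) _).2 ⟨?_, fun v => ?_⟩, fun h0 => ?_⟩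
  · refine (mem_gkComplex_succ_iff G21 ρK ρ𝔤 hGK.ad_compat 0 _).2 ⟨fun Z hZ => ⟨?_, ?_⟩, fun k => ?_⟩
    · obtain ⟨Y, rfl⟩ := hZ
      refine cochain_one_eq_zero _ fun X => ?_
      rw [lieDer_one_apply, sub_eq_zero, GKCarrier.bracket_def, oneCochain_apply, oneCochain_apply, Matrix.cons_val_zero,
        Matrix.cons_val_zero]
      exact (hlie Y X).symm
    · obtain ⟨Y, rfl⟩ := hZ
      refine AlternatingMap.ext fun v => ?_
      rw [ins_apply, AlternatingMap.zero_apply, oneCochain_apply, Matrix.cons_val_zero]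
      apply ι.symm.injective
      rw [hφ, map_zero]
      change (Y : Matrix (Fin 2 ⊕ Fin 1) (Fin 2 ⊕ Fin 1) ℂ) (Sum.inr 0) (Sum.inl 0) • kvec S 2 (-3) 2 + (Y : Matrix (Fin 2 ⊕ Fin 1) (Fin 2 ⊕ Fin 1) ℂ) (Sum.inr 0) (Sum.inl 1) • kvec S 2 (-3) 1 = 0
      rw [(compactLie_apply_inl_inr Y 0 0).2, (compactLie_apply_inl_inr Y 1 0).2, zero_smul, zero_smul, add_zero]
    · refine AlternatingMap.ext fun v => ?_
      rw [PairAction.act_apply, oneCochain_apply, oneCochain_apply]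
      change ρK k (ι.symm (φ (G21.Ad (Subgroup.inclusion G21.maximalCompact_le_carrier k⁻¹) (v 0)))) = ι.symm (φ (v 0))
      have e : ι.symm (φ (G21.Ad (Subgroup.inclusion G21.maximalCompact_le_carrier k⁻¹) (v 0))) =
          ρK k⁻¹ (ι.symm (φ (v 0))) := congrArg ι.symm (hK k⁻¹ (v 0))
      rw [e, ← Module.End.mul_apply, ← map_mul, mul_inv_cancel, map_one, Module.End.one_apply]
  · rw [cochain_one_apply (oneCochain G21.lie φ) v, oneCochain_apply, Matrix.cons_val_zero]
    apply ι.symm.injective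
    change ρ𝔤 (upqZ0 (Fin 2) (Fin 1)) (ι.symm (φ (v 0))) = ι.symm (_ • φ (v 0))
    rw [map_smul ι.symm, hφ, map_add, map_smul, map_smul, (upqZ0_kvec_two hacts hS).1,
      (upqZ0_kvec_two hacts hS).2]
    push_cast
    module
  · have h1 := congrArg (fun g : Cochain ℝ G21.lie (GKCarrier G21 ρ𝔤) 1 => ι.symm (g ![upqUnit ((0 : Fin 2), (0 : Fin 1)) 1])) h0
    simp only [oneCochain_apply, Matrix.cons_val_zero, AlternatingMap.zero_apply, map_zero, hφ, coe_upqUnit,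
      Matrix.fromBlocks_apply₂₁, Matrix.conjTranspose_apply, Matrix.single_apply_same, star_one, one_smul] at h1
    rw [Matrix.single_apply_of_row_ne (show (0 : Fin 2) ≠ 1 by decide), star_zero, zero_smul, add_zero,
      kvec_of_pos ⟨hS, by norm_num, le_refl _⟩] at h1
    exact one_ne_zero (Finsupp.single_eq_zero.1 h1)

end PType

/-! ## §C The head: payment of `sig_K2E1bClassEqArchDegOneOfPType` -/

/-- **PAYMENT OF `sig_K2E1bClassEqArchDegOneOfPType`** (socket #18, unit U6 «LEVEL-B PIN» of the K2_E1b road, TOKEN FOR TOKEN).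
**A coh-unitary `K`-type module with Casimir `0` containing a `𝔭`-type IS the class of record `[J^±]`.**  Let
`V = ⊕_{(n,m) ∈ S} V_{n,m}` carry an irreducible unitary cohomological `(𝔲(2,1), K)`-structure `(ρK, ρ𝔤)` whose `𝔨`-action is
Kovačević's (`ActsOnKTypes`) and on which the trace-form Casimir vanishes.  If `(2, 3) ∈ S` (resp. `(2, −3) ∈ S`) then the class of `V` is
★ `archDegOneClass 1` (resp. `archDegOneClass (−1)`).  PROOF: by unitarity along `𝔭` and Casimir `0` all `(𝔤, K)`-cochains are closed and
`C^• ≅ H^•` (BW II Cor. 3.3 ∕ Prop. 3.1, ★ `upq_d_eq_zero_of_casimir_eq_zero`, ★ `upqClassMap_bijective`); the explicit intertwiner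
`𝔭^± → V_{2,±3}` of §B is a non-zero relative 1-cochain of type `±1`, so `H¹_{±1} ≠ 0`, and ★ `ofModule_eq_archDegOneClass` (EXIT 2 rigidity,
BW VI Thm. 4.11 (1) ∕ Vogan–Zuckerman) identifies the class.  (The hypotheses `1 ≤ n` and the `ρK`-stability of the blocks are not needed:
`K = exp 𝔨` makes `ρK` a consequence of `ρ𝔤|_𝔨`.)
[cite: BorelWallach2000, VI Thm. 4.11 (1)–(3); II Prop. 3.1, Cor. 3.3; I §5.1] [cite: Rogawski1990, Prop. 15.2.1 (b)]
[cite: VoganZuckerman1984, Thm. 5.6] [cite: Kovacevic2021, §6] -/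
theorem classEqArchDegOneOfPType :
    ∀ (S : Set (ℤ × ℤ)) (ρK : Representation ℂ (uFormGroup (Fin 2) (Fin 1)).maximalCompact (KIdx S →₀ ℂ))
      (ρ𝔤 : (uFormGroup (Fin 2) (Fin 1)).lie →ₗ⁅ℝ⁆ Module.End ℂ (KIdx S →₀ ℂ)) (h : IsCohUnitaryIrrep ρK ρ𝔤),
      (∀ n m : ℤ, (n, m) ∈ S → 1 ≤ n) → ActsOnKTypes S ρ𝔤 →
        (∀ (g : (uFormGroup (Fin 2) (Fin 1)).maximalCompact) (n m k : ℤ),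
          ρK g (kvec S n m k) ∈ Submodule.span ℂ (Set.range fun l : ℤ => kvec S n m l)) →
        (∀ v : KIdx S →₀ ℂ, upqCasimirOp ρ𝔤 v = 0) →
          (((2 : ℤ), (3 : ℤ)) ∈ S ∨ ((2 : ℤ), (-3 : ℤ)) ∈ S) →
            ∃ (δ : ℤ) (hδ : δ = 1 ∨ δ = -1),
              GKIrrClass.ofModule (KIdx S →₀ ℂ) ρK ρ𝔤 h.gk h.irred = archDegOneClass δ hδ := by
  intro S ρK ρ𝔤 h _hn hacts _hK hC hp
  -- Casimir `0` + unitarity along `𝔭` ⇒ `d = 0` on `C^•(𝔲(2,1), K; V)`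
  obtain ⟨B, hBs, hB, hBd, hadj, -, -⟩ := h.unit
  have hc : ∀ v : KIdx S →₀ ℂ, upqCasimirOp ρ𝔤 v = (0 : ℂ) • v := fun v => by rw [hC v, zero_smul]
  have hd := upq_d_eq_zero_of_casimir_eq_zero ρK ρ𝔤 h.gk.ad_compat hBs hB hBd upq_casimir_hspan
    upq_lie_upqPBasis_mem_kInLie hadj upqKDual_mem upq_casimirTensor_lie_invariant hc rfl
  -- a non-zero cochain of type `δ` gives a non-zero class in `H¹_δ` (`C¹ ≅ H¹`)
  have key : ∀ (δ : ℤ) (f : Cochain ℝ G21.lie (GKCarrier G21 ρ𝔤) 1), f ∈ upqType ρK ρ𝔤 h.gk.ad_compat 1 δ → f ≠ 0 →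
      upqTypeClasses ρK ρ𝔤 h.gk.ad_compat 1 δ ≠ ⊥ := by
    intro δ f hft hf0
    have hfc := ((mem_upqType_iff ρK ρ𝔤 h.gk.ad_compat 1 δ f).1 hft).1
    rw [Submodule.ne_bot_iff]
    refine ⟨upqClassMap ρK ρ𝔤 h.gk.ad_compat hd 1 ⟨f, hfc⟩,
      (mem_upqTypeClasses_iff ρK ρ𝔤 h.gk.ad_compat hd 1 δ _).2 ⟨⟨f, hfc⟩, hft, rfl⟩, fun h0 => hf0 ?_⟩
    have h00 : (⟨f, hfc⟩ : (gkComplex G21 ρK ρ𝔤 h.gk.ad_compat).carrier 1) = 0 :=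
      (upqClassMap_bijective ρK ρ𝔤 h.gk.ad_compat hd 1).1 (by rw [h0, map_zero])
    exact congrArg Subtype.val h00
  rcases hp with hS | hS
  · obtain ⟨f, hft, hf0⟩ := exists_cochain_type_one h.gk hacts hS
    exact ⟨1, Or.inl rfl, ofModule_eq_archDegOneClass ρK ρ𝔤 h 1 (Or.inl rfl) (key 1 f hft hf0)⟩
  · obtain ⟨f, hft, hf0⟩ := exists_cochain_type_neg_one h.gk hacts hS
    exact ⟨-1, Or.inr rfl, ofModule_eq_archDegOneClass ρK ρ𝔤 h (-1) (Or.inr rfl) (key (-1) f hft hf0)⟩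

end Summit.HodgeConjecture.HodgeConjecture.Cruxes.H413.K2E1bClassEqArchDegOneOfPType

end
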